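import Literature.Computability.AlgebraicComplexity.BI17DegreeExponentMonoidProofs
import HarnessLib

/-!
# Bürgisser–Ikenmeyer 2017, §3.3: `e(det_n), e(per_n) ≥ n²`, equality iff `P_{n,n²} ≠ 0` — discharge

P. Bürgisser, C. Ikenmeyer, *Fundamental invariants of orbit closures*, J. Algebra **477** (2017)
390–434 = arXiv:1511.02927 [BurgisserIkenmeyer2017], §3.3 (`main.tex` L1456–1464) and Rem. 3.27:
"we obtain that `e(det_n) ≥ n²`, with equality holding iff `P_{n,n²}(det_n) ≠ 0`. (An analogous
statement holds for `per_n`.)"; "`det_2` and `per_2` are quadratic forms of full rank … Hence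
`P_{2,4}(det_2)` and `P_{2,4}(per_2)` are nonzero". Theorem-only companion of the file of record
`BI17FundamentalInvariantForms.lean` (val-lit row BI17-A, t04), which types this as the named fact
`BI2017_minimalDegree_det_per`.

Route. The printed argument is Thm. 3.15 (the tree's `BI2017_thm_3_15_holds`, val-lit t09,
`BI17DegreeExponentMonoidProofs.lean`) applied to the polystable forms `det_n`, `per_n`
(`BurgisserIkenmeyer2017_polystable_det_per_holds`). Thm. 3.15 is typed for forms in the variables
`Fin m`; `det_n`, `per_n` live in the variables `Fin n × Fin n`, so this file first proves that all
notions involved are **transported along a bijection of variables** `e : σ ≃ τ` (`rename e`):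
linear substitutions (`linSubst_rename_equiv`), `SL`/`GL`-orbits, polystability
(`IsPolystable.rename_equiv`), `SL`-invariance of polynomial functions on `Sym^D`
(`isSLInvariantCoord_iff_forall_aeval`), the degree monoid and the minimal degree
(`degreeMonoid_rename_equiv`, `minimalDegree_rename_equiv`) and the value of Cayley's `P_{D,m}`
(`aeval_formCoeff_rename_cayleyP`). Rem. 3.27 (`n = 2`): over `ℂ` an explicit substitution `B` turns
`det_2`, `per_2` into the sum of four squares, so `4! = P_{2,4}(∑ y_i²) = det(B)² P_{2,4}(det_2)`
(Thm. 3.18(1) in letters `t`, `aeval_formCoeff_linSubst_cayleyP`; Thm. 3.18(2),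
`BI2017_thm_3_18_2_powerSum`), whence `P_{2,4}(det_2) ≠ 0`, and likewise for `per_2`.

No new definitions; no facts introduced. Honest framing: statements about the minimal degree of
`det_n`, `per_n`; nothing here bears on VP versus VNP.

## References

* [BurgisserIkenmeyer2017] P. Bürgisser, C. Ikenmeyer, *Fundamental invariants of orbit closures*,
  J. Algebra 477 (2017) 390–434; arXiv:1511.02927, §3.3 (before Rem. 3.27), Rem. 3.27, Thm. 3.15,
  Thm. 3.18.
-/

open MvPolynomial

namespace Literature.Computability.AlgebraicComplexity

/-! ### Transport along a bijection of variables -/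

section Transport

variable {σ τ k : Type*} [Fintype σ] [Fintype τ] [DecidableEq σ] [DecidableEq τ] [Field k]
  (e : σ ≃ τ)

omit [DecidableEq σ] [DecidableEq τ] in
/-- Linear substitution commutes with renaming the variables along a bijection `e`:
`B · (rename e f) = rename e (B^e · f)` with `B^e = B.submatrix e e` (the substitution action
does not depend on the naming of the variables). [cite: MulmuleySohoni2001, §4] -/
theorem linSubst_rename_equiv (B : Matrix τ τ k) (f : MvPolynomial σ k) :
    linSubst τ k B (rename e f) = rename e (linSubst σ k (B.submatrix e e) f) := by
  have H : (linSubst τ k B).comp (rename e) = (rename e).comp (linSubst σ k (B.submatrix e e)) := by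
    apply MvPolynomial.algHom_ext
    intro i
    simp only [AlgHom.comp_apply, rename_X, linSubst_X, map_sum, map_smul, Matrix.submatrix_apply]
    exact (Equiv.sum_comp e fun j => B j (e i) • (X j : MvPolynomial τ k)).symm
  exact DFunLike.congr_fun H f

omit [Fintype σ] [Fintype τ] [DecidableEq σ] [DecidableEq τ] in
/-- Renaming along `e` and back. [folklore] -/
private theorem rename_symm_rename_equiv (f : MvPolynomial σ k) : rename e.symm (rename e f) = f := by
  rw [rename_rename, e.symm_comp_self, rename_id, AlgHom.id_apply]

omit [Fintype σ] [Fintype τ] [DecidableEq σ] [DecidableEq τ] in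
/-- Renaming back and along `e`. [folklore] -/
private theorem rename_rename_symm_equiv (f : MvPolynomial τ k) : rename e (rename e.symm f) = f := by
  rw [rename_rename, e.self_comp_symm, rename_id, AlgHom.id_apply]

/-- `SL · (rename e f) ⊇ rename e '' (SL · f)`. [folklore] -/
private theorem rename_mem_slOrbit_rename (f : MvPolynomial σ k) (h : Matrix.SpecialLinearGroup σ k) :
    rename e (linSubst σ k (h : Matrix σ σ k) f) ∈ slOrbit τ k (rename e f) := by
  refine ⟨⟨(h : Matrix σ σ k).submatrix e.symm e.symm, by
    rw [Matrix.det_submatrix_equiv_self]; exact h.prop⟩, ?_⟩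
  change _ = linSubst τ k ((h : Matrix σ σ k).submatrix e.symm e.symm) (rename e f)
  rw [linSubst_rename_equiv, Matrix.submatrix_submatrix, e.symm_comp_self, Matrix.submatrix_id_id]

/-- `SL · (rename e f) = rename e '' (SL · f)`: the `SL`-orbit does not depend on the naming of
the variables. [cite: BurgisserIkenmeyer2017, Def. 2.7 (§2.2)] -/
theorem slOrbit_rename_equiv (f : MvPolynomial σ k) :
    slOrbit τ k (rename e f) = rename e '' slOrbit σ k f := by
  ext p
  constructor
  · rintro ⟨g, rfl⟩
    refine ⟨linSubst σ k ((g : Matrix τ τ k).submatrix e e) f,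
      ⟨⟨(g : Matrix τ τ k).submatrix e e, by rw [Matrix.det_submatrix_equiv_self]; exact g.prop⟩,
        rfl⟩, ?_⟩
    rw [linSubst_rename_equiv]
  · rintro ⟨q, ⟨h, rfl⟩, rfl⟩
    exact rename_mem_slOrbit_rename e f h

omit [Fintype σ] [Fintype τ] [DecidableEq σ] [DecidableEq τ] in
/-- Coefficients of a renamed polynomial. [folklore] -/
private theorem coeff_rename_equiv (d : τ →₀ ℕ) (f : MvPolynomial σ k) :
    coeff d (rename e f) = coeff (Finsupp.equivMapDomain e.symm d) f := by
  have hd : d = Finsupp.mapDomain e (Finsupp.equivMapDomain e.symm d) := by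
    rw [← Finsupp.equivMapDomain_eq_mapDomain, ← Finsupp.equivMapDomain_trans,
      Equiv.symm_trans_self, Finsupp.equivMapDomain_refl]
  conv_lhs => rw [hd]
  exact coeff_rename_mapDomain e e.injective f _

/-- **Polystability is transported along a bijection of variables** (closedness of the
`SL`-orbit does not depend on the naming of the variables). [cite: BurgisserIkenmeyer2017, Def. 2.7] -/
theorem IsPolystable.rename_equiv {f : MvPolynomial σ k} (hf : IsPolystable f) :
    IsPolystable (rename e f) := by
  intro y hy
  -- pull `y` back to `σ`-coordinates
  set x : (σ →₀ ℕ) → k := fun d => y (Finsupp.equivMapDomain e d) with hx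
  have hyx : y = fun d => x (Finsupp.equivMapDomain e.symm d) := by
    funext d
    simp only [hx, ← Finsupp.equivMapDomain_trans, Equiv.symm_trans_self,
      Finsupp.equivMapDomain_refl]
  have hcv : ∀ q : MvPolynomial σ k,
      coeffVec (rename e q) = fun d => coeffVec q (Finsupp.equivMapDomain e.symm d) := by
    intro q
    funext d
    rw [coeffVec_apply, coeffVec_apply, coeff_rename_equiv]
  have hx_mem : x ∈ zariskiClosure (coeffVec '' slOrbit σ k f) := by
    rw [mem_zariskiClosure_iff]
    intro p hp
    have hy' := (mem_zariskiClosure_iff.mp hy) (rename (Finsupp.equivMapDomain e) p) ?_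
    · rw [aeval_rename, hyx] at hy'
      have hcomp : ((fun d => x (Finsupp.equivMapDomain e.symm d)) ∘ Finsupp.equivMapDomain e) = x := by
        funext d
        simp only [Function.comp_apply, ← Finsupp.equivMapDomain_trans, Equiv.self_trans_symm,
          Finsupp.equivMapDomain_refl]
      rwa [hcomp] at hy'
    · rintro _ ⟨q, hq, rfl⟩
      rw [slOrbit_rename_equiv] at hq
      obtain ⟨q₀, hq₀, rfl⟩ := hq
      rw [aeval_rename, hcv]
      have hcomp : ((fun d => coeffVec q₀ (Finsupp.equivMapDomain e.symm d)) ∘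
          Finsupp.equivMapDomain e) = coeffVec q₀ := by
        funext d
        simp only [Function.comp_apply, ← Finsupp.equivMapDomain_trans, Equiv.self_trans_symm,
          Finsupp.equivMapDomain_refl]
      rw [hcomp]
      exact hp _ ⟨q₀, hq₀, rfl⟩
  obtain ⟨q₀, hq₀, hq₀x⟩ := hf hx_mem
  refine ⟨rename e q₀, ?_, ?_⟩
  · rw [slOrbit_rename_equiv]
    exact ⟨q₀, hq₀, rfl⟩
  · rw [hcv, hq₀x, hyx]

omit [Fintype σ] [DecidableEq σ] in
/-- Coefficients of degree-`D` coordinates of a renamed form. [folklore] -/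
private theorem formCoeff_rename_equiv (D : ℕ) (f : MvPolynomial σ k) (d : DegIdx τ D) :
    formCoeff D (rename e f) d = coeff (Finsupp.equivMapDomain e.symm d.1) f := by
  rw [formCoeff_apply, coeff_rename_equiv]

/-- Degree is preserved by `Finsupp.equivMapDomain`. [folklore] -/
private theorem equivMapDomain_mem_degMonomials {D : ℕ} {d : σ →₀ ℕ} (hd : d ∈ degMonomials σ D) :
    Finsupp.equivMapDomain e d ∈ degMonomials τ D := by
  rw [mem_degMonomials_iff, Finsupp.equivMapDomain_eq_mapDomain, Finsupp.degree_mapDomain]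
  exact mem_degMonomials_iff.mp hd

/-- **`SL`-invariance of a polynomial function on `Sym^D` as an evaluation identity** (infinite
field, so that polynomials are functions): `F` is `SL`-invariant iff `F(g · q) = F(q)` for all
`g ∈ SL` and all forms `q` of degree `D`. [cite: BurgisserIkenmeyer2017, §3 (O(Sym^D)^{SL_m})] -/
theorem isSLInvariantCoord_iff_forall_aeval [Infinite k] {D : ℕ} {F : MvPolynomial (DegIdx σ D) k} :
    IsSLInvariantCoord D F ↔ ∀ (g : Matrix.SpecialLinearGroup σ k) (q : MvPolynomial σ k),
      q.IsHomogeneous D →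
        aeval (formCoeff D (linSubst σ k (g : Matrix σ σ k) q)) F = aeval (formCoeff D q) F := by
  constructor
  · intro hF g q _
    exact hF.aeval_formCoeff_linSubst g q
  · intro h g
    apply MvPolynomial.funext
    intro w
    obtain ⟨q, hq, rfl⟩ := exists_formCoeff_eq w
    change aeval (formCoeff D q) (coordSubst D (Matrix.SpecialLinearGroup.toGL g) F) =
      aeval (formCoeff D q) F
    rw [aeval_formCoeff_coordSubst, linSubstRep_apply, ← map_inv,
      Matrix.SpecialLinearGroup.coe_GL_coe_matrix]
    exact h g⁻¹ q hq

/-- **The degree monoid grows at most along a renaming of variables**: every `d ∈ E(w)` lies in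
`E(rename e w)` (transport the witnessing invariant along `e`). [cite: BurgisserIkenmeyer2017, Def. 3.3] -/
theorem degreeMonoid_subset_degreeMonoid_rename [Infinite k] (D : ℕ) (f : MvPolynomial σ k) :
    degreeMonoid D f ⊆ degreeMonoid D (rename e f) := by
  classical
  rintro d ⟨F, hFh, hFi, hFI⟩
  -- the transported coordinates and invariant
  let φ : DegIdx σ D → DegIdx τ D := fun c =>
    ⟨Finsupp.equivMapDomain e c.1, equivMapDomain_mem_degMonomials e c.2⟩
  have hφ : ∀ q : MvPolynomial σ k, (formCoeff D (rename e q)) ∘ φ = formCoeff D q := by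
    intro q
    funext c
    simp only [Function.comp_apply, φ, formCoeff_apply]
    rw [coeff_rename_equiv, ← Finsupp.equivMapDomain_trans, Equiv.self_trans_symm,
      Finsupp.equivMapDomain_refl]
  have heval : ∀ q' : MvPolynomial τ k,
      aeval (formCoeff D q') (rename φ F) = aeval (formCoeff D (rename e.symm q')) F := by
    intro q'
    rw [aeval_rename, ← hφ (rename e.symm q'), rename_rename_symm_equiv]
  refine ⟨rename φ F, hFh.rename_isHomogeneous, ?_, ?_⟩
  · -- `SL`-invariance transports
    rw [isSLInvariantCoord_iff_forall_aeval]
    intro g q' _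
    have hsub : linSubst τ k (g : Matrix τ τ k) q' =
        rename e (linSubst σ k ((g : Matrix τ τ k).submatrix e e) (rename e.symm q')) := by
      conv_lhs => rw [← rename_rename_symm_equiv e q']
      rw [linSubst_rename_equiv]
    rw [heval, heval, hsub, rename_symm_rename_equiv]
    exact hFi.aeval_formCoeff_linSubst ⟨(g : Matrix τ τ k).submatrix e e, by
      rw [Matrix.det_submatrix_equiv_self]; exact g.prop⟩ (rename e.symm q')
  · -- nonvanishing on the orbit transports
    intro hmem
    apply hFI
    rw [mem_orbitVanishingIdeal_iff] at hmem ⊢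
    intro g
    have hdet : ((g : Matrix σ σ k).submatrix e.symm e.symm).det ≠ 0 := by
      rw [Matrix.det_submatrix_equiv_self, ← Matrix.GeneralLinearGroup.val_det_apply]
      exact (Matrix.GeneralLinearGroup.det g).ne_zero
    have h1 := hmem (Matrix.GeneralLinearGroup.mkOfDetNeZero _ hdet)
    rw [heval, linSubstRep_apply, Matrix.GeneralLinearGroup.val_mkOfDetNeZero,
      linSubst_rename_equiv, rename_symm_rename_equiv, Matrix.submatrix_submatrix,
      e.symm_comp_self, Matrix.submatrix_id_id] at h1
    rwa [linSubstRep_apply]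

/-- **The degree monoid is invariant under renaming the variables along a bijection.**
[cite: BurgisserIkenmeyer2017, Def. 3.3] -/
theorem degreeMonoid_rename_equiv [Infinite k] (D : ℕ) (f : MvPolynomial σ k) :
    degreeMonoid D (rename e f) = degreeMonoid D f := by
  refine Set.Subset.antisymm ?_ (degreeMonoid_subset_degreeMonoid_rename e D f)
  have h := degreeMonoid_subset_degreeMonoid_rename e.symm D (rename e f)
  rwa [rename_symm_rename_equiv] at h

/-- **The minimal degree is invariant under renaming the variables along a bijection.**
[cite: BurgisserIkenmeyer2017, Def. 3.3] -/
theorem minimalDegree_rename_equiv [Infinite k] (D : ℕ) (f : MvPolynomial σ k) :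
    minimalDegree D (rename e f) = minimalDegree D f := by
  simp only [minimalDegree, degreeMonoid_rename_equiv]

end Transport

/-! ### Cayley's `P_{D,m}` under renaming and under linear substitution (letters `t`) -/

section Cayley

variable {σ τ k : Type*} [Fintype σ] [Fintype τ] [DecidableEq σ] [DecidableEq τ] [Field k]
  {m D : ℕ}

omit [Fintype σ] [Fintype τ] [DecidableEq σ] [DecidableEq τ] [Field k] in
/-- The content of a word read through a bijection of letters. [folklore] -/
private theorem wordExp_comp_equiv (e : σ ≃ τ) (I : Fin D → σ) :
    wordExp (e ∘ I) = Finsupp.equivMapDomain e (wordExp I) := by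
  rw [Finsupp.equivMapDomain_eq_mapDomain, wordExp, wordExp, Finsupp.mapDomain_finsetSum]
  simp only [Function.comp_apply, Finsupp.mapDomain_single]

/-- The symmetric array of a renamed form is the array of the form on the pulled-back words.
[folklore] -/
private theorem arrOf_rename_equiv (e : σ ≃ τ) (f : MvPolynomial σ k) (J : Fin D → τ) :
    arrOf D (rename e f) J = arrOf D f (e.symm ∘ J) := by
  classical
  have hJ : wordExp J = Finsupp.equivMapDomain e (wordExp (e.symm ∘ J)) := by
    rw [← wordExp_comp_equiv, ← Function.comp_assoc, e.self_comp_symm, Function.id_comp]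
  have hset : (Finset.univ.filter fun I : Fin D → τ => wordExp I = wordExp J) =
      (Finset.univ.filter fun I : Fin D → σ => wordExp I = wordExp (e.symm ∘ J)).map
        ⟨fun I => e ∘ I, fun I I' h => funext fun x => e.injective (congrFun h x)⟩ := by
    ext I
    simp only [Finset.mem_filter, Finset.mem_univ, true_and, Finset.mem_map,
      Function.Embedding.coeFn_mk]
    constructor
    · intro h
      refine ⟨e.symm ∘ I, ?_, ?_⟩
      · rw [wordExp_comp_equiv, wordExp_comp_equiv, h]
      · funext x
        simp
    · rintro ⟨I', h, rfl⟩
      rw [wordExp_comp_equiv, h, ← wordExp_comp_equiv, ← Function.comp_assoc, e.self_comp_symm,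
        Function.id_comp]
  unfold arrOf
  rw [hset, Finset.card_map, coeff_rename_equiv, hJ, ← Finsupp.equivMapDomain_trans,
    Equiv.self_trans_symm, Finsupp.equivMapDomain_refl]

/-- **`P_{D,m}` is compatible with renaming the variables**: the value of `P_{D,m}` in the letters
`t` followed by `e` at `rename e f` is its value in the letters `t` at `f`.
[cite: BurgisserIkenmeyer2017, eq. (3.5)] -/
theorem aeval_formCoeff_rename_cayleyP (e : σ ≃ τ) (t : Fin m ≃ σ) (f : MvPolynomial σ k) :
    aeval (formCoeff D (rename e f)) (cayleyP (k := k) D (t.trans e)) =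
      aeval (formCoeff D f) (cayleyP (k := k) D t) := by
  rw [cayleyP, cayleyP, aeval_formCoeff_hyperdetPoly, aeval_formCoeff_hyperdetPoly]
  congr 1
  funext J
  rw [arrOf_rename_equiv]
  congr 1
  funext x
  simp

omit [Fintype τ] [DecidableEq τ] in
/-- **Thm. 3.18(1) in letters `t`**: `P_{D,m}(B · q) = det(B^t)^D P_{D,m}(q)` for every square
matrix `B` (acting by `linSubst`) and every form `q` of degree `D`, where `B^t = B.submatrix t t`
is `B` read in the letters `t : [m] ≃ σ` (`arrOf_linSubst` + `hyperdet_tensorMul`; characteristic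
zero). [cite: BurgisserIkenmeyer2017, Thm. 3.18(1)] -/
theorem aeval_formCoeff_linSubst_cayleyP [CharZero k] (t : Fin m ≃ σ) (B : Matrix σ σ k)
    {q : MvPolynomial σ k} (hq : q.IsHomogeneous D) :
    aeval (formCoeff D (linSubst σ k B q)) (cayleyP (k := k) D t) =
      (B.submatrix t t).det ^ D * aeval (formCoeff D q) (cayleyP (k := k) D t) := by
  rw [cayleyP, aeval_formCoeff_hyperdetPoly, aeval_formCoeff_hyperdetPoly]
  have harr : (fun J : Fin D → Fin m => arrOf D (linSubst σ k B q) (t ∘ J)) =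
      fun I => ∑ J : Fin D → Fin m, (∏ r, (B.submatrix t t) (I r) (J r)) * arrOf D q (t ∘ J) := by
    funext I
    rw [arrOf_linSubst B hq]
    exact (Fintype.sum_equiv (Equiv.arrowCongr (Equiv.refl (Fin D)) t) _ _ fun J => rfl).symm
  rw [harr, hyperdet_tensorMul]

end Cayley

/-! ### `det_n`, `per_n`: Thm. 3.15 transported, and Rem. 3.27 (`n = 2`) -/

section DetPer

variable {n : ℕ}

/-- **`e(w) ≥ n²`, with equality iff `P_{n,n²}(w) ≠ 0`**, for a polystable nonzero form `w` of
degree `n ≥ 2` in the `n²` variables `Fin n × Fin n` (Thm. 3.15 = `BI2017_thm_3_15_holds`,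
transported along `finProdFinEquiv`; for odd `n` both sides of the equivalence fail: `e(w) > n²`
and `P_{n,n²} = 0`, `cayleyP_eq_zero_of_odd`). [cite: BurgisserIkenmeyer2017, §3.3 (before Rem. 3.27)] -/
theorem minimalDegree_sq_of_isPolystable (hn : 2 ≤ n) {f : MvPolynomial (Fin n × Fin n) ℂ}
    (hf : f.IsHomogeneous n) (hf0 : f ≠ 0) (hps : IsPolystable f) :
    n * n ≤ minimalDegree n f ∧
      (minimalDegree n f = n * n ↔
        aeval (formCoeff n f)
          (cayleyP (k := ℂ) n (finProdFinEquiv.symm : Fin (n * n) ≃ Fin n × Fin n)) ≠ 0) := by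
  set e : Fin n × Fin n ≃ Fin (n * n) := finProdFinEquiv with he
  have hm : 2 ≤ n * n := le_trans hn (Nat.le_mul_self n)
  have hf' : (rename e f).IsHomogeneous n := hf.rename_isHomogeneous
  have hf0' : rename e f ≠ 0 := fun h =>
    hf0 (rename_injective _ e.injective (by rw [h, map_zero]))
  obtain ⟨hle, hodd, heven, -⟩ :=
    BI2017_thm_3_15_holds (n * n) n (rename e f) hm hn hf' hf0' (hps.rename_equiv e)
  rw [minimalDegree_rename_equiv] at hle hodd heven
  have hP : aeval (formCoeff n (rename e f)) (cayleyP (k := ℂ) n (Equiv.refl (Fin (n * n)))) =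
      aeval (formCoeff n f) (cayleyP (k := ℂ) n e.symm) := by
    have h := aeval_formCoeff_rename_cayleyP (D := n) e e.symm f
    rwa [Equiv.symm_trans_self] at h
  refine ⟨hle, ?_⟩
  rcases Nat.even_or_odd n with hev | hod
  · rw [heven hev, hP]
  · have hlt := hodd hod
    constructor
    · intro h
      omega
    · intro h
      exact (h (by rw [cayleyP_eq_zero_of_odd hod hm, map_zero])).elim

/-- `det_n ≠ 0` (its value at the identity matrix is `1`). [folklore] -/
private theorem detPoly_fin_ne_zero (n : ℕ) : detPoly (Fin n) ℂ ≠ 0 := by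
  intro h
  have h1 := eval_detPoly (n := Fin n) (k := ℂ) (fun p => if p.1 = p.2 then 1 else 0)
  rw [h, map_zero, show (Matrix.of fun i j : Fin n => if i = j then (1 : ℂ) else 0) = 1 from by
    ext i j; simp [Matrix.one_apply], Matrix.det_one] at h1
  exact zero_ne_one h1

/-- `per_n ≠ 0` (its value at the identity matrix is `1`). [folklore] -/
private theorem perPoly_fin_ne_zero (n : ℕ) : perPoly (Fin n) ℂ ≠ 0 := by
  intro h
  have h1 := eval_perPoly (n := Fin n) (k := ℂ) (fun p => if p.1 = p.2 then 1 else 0)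
  rw [h, map_zero, show (Matrix.of fun i j : Fin n => if i = j then (1 : ℂ) else 0) = 1 from by
    ext i j; simp [Matrix.one_apply], Matrix.permanent_one] at h1
  exact zero_ne_one h1

/-- `C I · C I = -1` in a polynomial ring over `ℂ`. [folklore] -/
private theorem C_I_mul_C_I {ι : Type*} : (C Complex.I : MvPolynomial ι ℂ) * C Complex.I = -1 := by
  rw [← map_mul, Complex.I_mul_I, map_neg, map_one]

/-- `det_2`, renamed into the four variables `Fin 4` (`x_{ij} ↦ y_{2i+j}`), is `y_0 y_3 - y_1 y_2`.
[folklore] -/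
private theorem rename_detPoly_two :
    rename (finProdFinEquiv : Fin 2 × Fin 2 ≃ Fin 4) (detPoly (Fin 2) ℂ) =
      X 0 * X 3 - X 1 * X 2 := by
  have hdet : detPoly (Fin 2) ℂ = X (0, 0) * X (1, 1) - X (0, 1) * X (1, 0) := by
    rw [detPoly, Matrix.det_fin_two]
    simp [Matrix.mvPolynomialX_apply]
  rw [hdet, map_sub, map_mul, map_mul, rename_X, rename_X, rename_X, rename_X]
  rfl

/-- `per_2`, renamed into the four variables `Fin 4`, is `y_0 y_3 + y_1 y_2`. [folklore] -/
private theorem rename_perPoly_two :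
    rename (finProdFinEquiv : Fin 2 × Fin 2 ≃ Fin 4) (perPoly (Fin 2) ℂ) =
      X 0 * X 3 + X 1 * X 2 := by
  have huniv : (Finset.univ : Finset (Equiv.Perm (Fin 2))) = {1, Equiv.swap 0 1} := by decide
  have hper : perPoly (Fin 2) ℂ = X (0, 0) * X (1, 1) + X (0, 1) * X (1, 0) := by
    rw [perPoly, Matrix.permanent, huniv, Finset.sum_pair (by decide), Fin.prod_univ_two,
      Fin.prod_univ_two]
    simp [Matrix.mvPolynomialX_apply, Equiv.swap_apply_left, Equiv.swap_apply_right]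
    ring
  rw [hper, map_add, map_mul, map_mul, rename_X, rename_X, rename_X, rename_X]
  rfl

/-- **Rem. 3.27 for `det_2`**: the substitution `y_0 ↦ y_0 + i y_1`, `y_3 ↦ y_0 - i y_1`,
`y_1 ↦ i y_2 - y_3`, `y_2 ↦ i y_2 + y_3` turns `y_0 y_3 - y_1 y_2` into `∑_a y_a²` (`det_2` is a
quadratic form of full rank over `ℂ`). [cite: BurgisserIkenmeyer2017, Rem. 3.27] -/
private theorem linSubst_detTwo_eq_powerSum :
    linSubst (Fin 4) ℂ !![1, 0, 0, 1; Complex.I, 0, 0, -Complex.I; 0, Complex.I, Complex.I, 0;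
        0, -1, 1, 0] (X 0 * X 3 - X 1 * X 2) =
      ∑ a : Fin 4, X ((Equiv.refl (Fin 4)) a) ^ 2 := by
  simp [linSubst_X, Fin.sum_univ_four, smul_eq_C_mul]
  linear_combination (-(X 1 : MvPolynomial (Fin 4) ℂ) ^ 2 - X 2 ^ 2) * C_I_mul_C_I

/-- **Rem. 3.27 for `per_2`**: the substitution `y_0 ↦ y_0 + i y_1`, `y_3 ↦ y_0 - i y_1`,
`y_1 ↦ y_2 + i y_3`, `y_2 ↦ y_2 - i y_3` turns `y_0 y_3 + y_1 y_2` into `∑_a y_a²`.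
[cite: BurgisserIkenmeyer2017, Rem. 3.27] -/
private theorem linSubst_perTwo_eq_powerSum :
    linSubst (Fin 4) ℂ !![1, 0, 0, 1; Complex.I, 0, 0, -Complex.I; 0, 1, 1, 0;
        0, Complex.I, -Complex.I, 0] (X 0 * X 3 + X 1 * X 2) =
      ∑ a : Fin 4, X ((Equiv.refl (Fin 4)) a) ^ 2 := by
  simp [linSubst_X, Fin.sum_univ_four, smul_eq_C_mul]
  linear_combination (-(X 1 : MvPolynomial (Fin 4) ℂ) ^ 2 - X 3 ^ 2) * C_I_mul_C_I

/-- **Rem. 3.27**: `P_{2,4}(q) ≠ 0` for a quadratic form `q` on `ℂ^{2×2}` whose renaming into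
`Fin 4` is turned into `∑_a y_a²` by some substitution `B`: `4! = P_{2,4}(∑ y_a²) = det(B)² ·
P_{2,4}(q)` (Thm. 3.18(1),(2): `BI2017_thm_3_18_1`, `BI2017_thm_3_18_2_powerSum`, after
`aeval_formCoeff_rename_cayleyP`). [cite: BurgisserIkenmeyer2017, Rem. 3.27] -/
private theorem aeval_cayleyP_two_ne_zero {q : MvPolynomial (Fin 2 × Fin 2) ℂ}
    (hq : q.IsHomogeneous 2) (B : Matrix (Fin 4) (Fin 4) ℂ)
    (hB : linSubst (Fin 4) ℂ B (rename (finProdFinEquiv : Fin 2 × Fin 2 ≃ Fin 4) q) =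
      ∑ a : Fin 4, X ((Equiv.refl (Fin 4)) a) ^ 2) :
    aeval (formCoeff 2 q)
      (cayleyP (k := ℂ) 2 (finProdFinEquiv : Fin 2 × Fin 2 ≃ Fin 4).symm) ≠ 0 := by
  set e : Fin 2 × Fin 2 ≃ Fin 4 := finProdFinEquiv with he
  intro h0
  have hP : aeval (formCoeff 2 (rename e q)) (cayleyP (k := ℂ) 2 (Equiv.refl (Fin 4))) =
      aeval (formCoeff 2 q) (cayleyP (k := ℂ) 2 e.symm) := by
    have h := aeval_formCoeff_rename_cayleyP (D := 2) e e.symm q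
    rwa [Equiv.symm_trans_self] at h
  have h1 := BI2017_thm_3_18_1 (k := ℂ) (D := 2) B (q := rename e q) hq.rename_isHomogeneous
  rw [hP, h0, mul_zero, hB, BI2017_thm_3_18_2_powerSum (k := ℂ) (by decide) (by decide)] at h1
  exact Nat.cast_ne_zero.mpr (Nat.factorial_ne_zero 4) h1

/-- **BI 2017, §3.3 (`e(det_n)`, `e(per_n)`) and Rem. 3.27 DISCHARGED.**
[cite: BurgisserIkenmeyer2017, §3.3 (before Rem. 3.27) and Rem. 3.27] -/
theorem BI2017_minimalDegree_det_per_holds : BI2017_minimalDegree_det_per := by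
  refine ⟨fun n hn => ⟨?_, ?_⟩, ?_, ?_⟩
  · exact minimalDegree_sq_of_isPolystable hn
      (by simpa using detPoly_isHomogeneous (n := Fin n) (k := ℂ)) (detPoly_fin_ne_zero n)
      (BurgisserIkenmeyer2017_polystable_det_per_holds n).1
  · exact minimalDegree_sq_of_isPolystable hn
      (by simpa using perPoly_isHomogeneous (n := Fin n) (k := ℂ)) (perPoly_fin_ne_zero n)
      (BurgisserIkenmeyer2017_polystable_det_per_holds n).2
  · exact aeval_cayleyP_two_ne_zero
      (by simpa using detPoly_isHomogeneous (n := Fin 2) (k := ℂ)) _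
      (by rw [rename_detPoly_two]; exact linSubst_detTwo_eq_powerSum)
  · exact aeval_cayleyP_two_ne_zero
      (by simpa using perPoly_isHomogeneous (n := Fin 2) (k := ℂ)) _
      (by rw [rename_perPoly_two]; exact linSubst_perTwo_eq_powerSum)

end DetPer

/-! ### More transport: the stabilizer period and the orbit-closure coordinate ring

(API for Cor. 3.29(2), assembled by val-lit t09 in `BI17NonNormalOrbitClosuresProofs.lean`:
Cor. 3.17(1) is typed over `Fin m`, `det_n`/`per_n` live over `Fin n × Fin n`.) -/

section TransportRing

variable {σ τ k : Type*} [Fintype σ] [Fintype τ] [DecidableEq σ] [DecidableEq τ] [Field k]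
  (e : σ ≃ τ)

/-- **`det(stab(w))` is invariant under renaming the variables along a bijection**: the
stabilizer of `rename e f` is the reindexed stabilizer of `f`, with the same determinants
(BI 2017 §2.1, `H = det(stab(w))`). [cite: BurgisserIkenmeyer2017, §2.1] -/
theorem stabilizerDetImage_rename_equiv (f : MvPolynomial σ k) :
    stabilizerDetImage (rename e f) = stabilizerDetImage f := by
  ext u
  rw [mem_stabilizerDetImage_iff, mem_stabilizerDetImage_iff]
  constructor
  · rintro ⟨γ, hγ, rfl⟩
    have hdet : ((γ : Matrix τ τ k).submatrix e e).det ≠ 0 := by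
      rw [Matrix.det_submatrix_equiv_self, ← Matrix.GeneralLinearGroup.val_det_apply]
      exact (Matrix.GeneralLinearGroup.det γ).ne_zero
    refine ⟨Matrix.GeneralLinearGroup.mkOfDetNeZero _ hdet, ?_, ?_⟩
    · rw [mem_linStabilizer, linSubstRep_apply, linSubst_rename_equiv] at hγ
      rw [mem_linStabilizer, linSubstRep_apply, Matrix.GeneralLinearGroup.val_mkOfDetNeZero]
      exact rename_injective _ e.injective hγ
    · ext
      rw [Matrix.GeneralLinearGroup.val_det_apply, Matrix.GeneralLinearGroup.val_det_apply,
        Matrix.GeneralLinearGroup.val_mkOfDetNeZero, Matrix.det_submatrix_equiv_self]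
  · rintro ⟨γ, hγ, rfl⟩
    have hdet : ((γ : Matrix σ σ k).submatrix e.symm e.symm).det ≠ 0 := by
      rw [Matrix.det_submatrix_equiv_self, ← Matrix.GeneralLinearGroup.val_det_apply]
      exact (Matrix.GeneralLinearGroup.det γ).ne_zero
    refine ⟨Matrix.GeneralLinearGroup.mkOfDetNeZero _ hdet, ?_, ?_⟩
    · rw [mem_linStabilizer, linSubstRep_apply] at hγ
      rw [mem_linStabilizer, linSubstRep_apply, Matrix.GeneralLinearGroup.val_mkOfDetNeZero,
        linSubst_rename_equiv, Matrix.submatrix_submatrix, e.symm_comp_self,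
        Matrix.submatrix_id_id, hγ]
    · ext
      rw [Matrix.GeneralLinearGroup.val_det_apply, Matrix.GeneralLinearGroup.val_det_apply,
        Matrix.GeneralLinearGroup.val_mkOfDetNeZero, Matrix.det_submatrix_equiv_self]

/-- **The stabilizer period `a(w)` is invariant under renaming the variables along a bijection.**
[cite: BurgisserIkenmeyer2017, Def. 2.2] -/
theorem stabilizerPeriod_rename_equiv (f : MvPolynomial σ k) :
    stabilizerPeriod (rename e f) = stabilizerPeriod f := by
  rw [stabilizerPeriod_def, stabilizerPeriod_def, stabilizerDetImage_rename_equiv]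

/-- **The degree period `b(w) = m a(w)/D` is invariant under renaming the variables along a
bijection** (`|σ| = |τ|`). [cite: BurgisserIkenmeyer2017, §3.1 (b(w))] -/
theorem degreePeriod_rename_equiv (D : ℕ) (f : MvPolynomial σ k) :
    degreePeriod D (rename e f) = degreePeriod D f := by
  rw [degreePeriod, degreePeriod, stabilizerPeriod_rename_equiv, Fintype.card_congr e]

/-- **Normality of the orbit closure does not depend on the naming of the variables**: the
coordinate rings `k[Sym^D] ⧸ I(GL · rename e f)` and `k[Sym^D] ⧸ I(GL · f)` are isomorphic (rename
the degree-`D` coordinates along `e`), so one is integrally closed iff the other is.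
[cite: BurgisserIkenmeyer2017, Thm. 3.10 (normality of \overline{Gw})] -/
theorem isIntegrallyClosed_orbitCoordRing_rename_iff (D : ℕ) (f : MvPolynomial σ k) :
    IsIntegrallyClosed (OrbitCoordRing (rename e f) D) ↔ IsIntegrallyClosed (OrbitCoordRing f D) := by
  classical
  -- the induced bijection of degree-`D` coordinates and the renaming ring isomorphism
  let eD : DegIdx σ D ≃ DegIdx τ D := (Finsupp.equivCongrLeft e).subtypeEquiv fun d =>
    ⟨fun h => equivMapDomain_mem_degMonomials e h, fun h => by
      have h' := equivMapDomain_mem_degMonomials e.symm h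
      rwa [Finsupp.equivCongrLeft_apply, ← Finsupp.equivMapDomain_trans, Equiv.self_trans_symm,
        Finsupp.equivMapDomain_refl] at h'⟩
  let Φ : MvPolynomial (DegIdx σ D) k ≃+* MvPolynomial (DegIdx τ D) k :=
    (renameEquiv k eD).toRingEquiv
  have hΦsymm : ∀ F' : MvPolynomial (DegIdx τ D) k, Φ.symm F' = rename eD.symm F' := fun F' => rfl
  -- evaluation of a pulled-back function: `(rename eD⁻¹ F')(q) = F'(rename e q)`
  have heval : ∀ (F' : MvPolynomial (DegIdx τ D) k) (q : MvPolynomial σ k),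
      aeval (formCoeff D q) (rename eD.symm F') = aeval (formCoeff D (rename e q)) F' := by
    intro F' q
    rw [aeval_rename]
    congr 2
    funext d
    rw [Function.comp_apply, formCoeff_rename_equiv, formCoeff_apply]
    rfl
  -- the vanishing ideal of the orbit corresponds under `Φ`
  have hIJ : orbitVanishingIdeal (rename e f) D =
      (orbitVanishingIdeal f D).map (Φ : MvPolynomial (DegIdx σ D) k →+* _) := by
    rw [Ideal.map_comap_of_equiv]
    ext F'
    rw [Ideal.mem_comap, hΦsymm, mem_orbitVanishingIdeal_iff, mem_orbitVanishingIdeal_iff]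
    constructor
    · intro h g
      have hdet : ((g : Matrix σ σ k).submatrix e.symm e.symm).det ≠ 0 := by
        rw [Matrix.det_submatrix_equiv_self, ← Matrix.GeneralLinearGroup.val_det_apply]
        exact (Matrix.GeneralLinearGroup.det g).ne_zero
      have h1 := h (Matrix.GeneralLinearGroup.mkOfDetNeZero _ hdet)
      rw [linSubstRep_apply, Matrix.GeneralLinearGroup.val_mkOfDetNeZero, linSubst_rename_equiv,
        Matrix.submatrix_submatrix, e.symm_comp_self, Matrix.submatrix_id_id] at h1
      rw [heval, linSubstRep_apply]
      exact h1
    · intro h g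
      have hdet : ((g : Matrix τ τ k).submatrix e e).det ≠ 0 := by
        rw [Matrix.det_submatrix_equiv_self, ← Matrix.GeneralLinearGroup.val_det_apply]
        exact (Matrix.GeneralLinearGroup.det g).ne_zero
      have h1 := h (Matrix.GeneralLinearGroup.mkOfDetNeZero _ hdet)
      rw [heval, linSubstRep_apply, Matrix.GeneralLinearGroup.val_mkOfDetNeZero] at h1
      rw [linSubstRep_apply, linSubst_rename_equiv]
      exact h1
  let Ψ : OrbitCoordRing f D ≃+* OrbitCoordRing (rename e f) D :=
    Ideal.quotientEquiv (orbitVanishingIdeal f D) (orbitVanishingIdeal (rename e f) D) Φ hIJ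
  exact ⟨fun h => IsIntegrallyClosed.of_equiv Ψ.symm, fun h => IsIntegrallyClosed.of_equiv Ψ⟩

end TransportRing

end Literature.Computability.AlgebraicComplexity
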